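import Literature.Barriers.CriticalPhenomena.FKParafermionicHalfCauchyRiemann

/-!
# Lattice count for the line `Sketch` of the crux `CardySusyWard.WeakHolomorphy`

Stub `stub_count` of the skeleton (stmt-CriticalPhenomena-11292): the medial vertices of `δℤ²`
whose midpoint lies in the closed `1`-thickening of a compact set `K ⊂ ℂ` are contained, for
every mesh `0 < δ ≤ 1`, in a finite box of cardinality `≤ C δ⁻²`, `C` depending on `K` only.
Elementary lattice-point counting (no probability).
-/

noncomputable section

namespace Summit.CriticalPhenomena.CardyFormulaZ2.Theorems.WeakHolomorphy.SplitBypass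

open scoped BigOperators
open _root_.Literature.Probability.LatticeModels
open _root_.Literature.Barriers.CriticalPhenomena (medialCornersAt medialVertexOf halfCRForm HalfCRRelationAt)
open _root_.Literature.Barriers.CriticalPhenomena.HalfCRGreen (coeff twin)

/-- Coordinate bookkeeping: if the midpoint coordinate `(δ a + δ (a + s)) / 2`, `s ∈ {0, 1}`,
is at most `R + 1` in absolute value and `0 < δ ≤ 1`, then `δ |a| ≤ R + 2`. [folklore] -/
private theorem coord_bound {δ R a : ℝ} {s : ℤ} (hδ : 0 < δ) (hδ1 : δ ≤ 1) (hs0 : 0 ≤ s)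
    (hs1 : s ≤ 1) (h : |(δ * a + δ * (a + (s : ℝ))) / 2| ≤ R + 1) : δ * |a| ≤ R + 2 := by
  have hs0' : (0 : ℝ) ≤ s := by exact_mod_cast hs0
  have hs1' : (s : ℝ) ≤ 1 := by exact_mod_cast hs1
  have h1 : 0 ≤ δ * (s : ℝ) := mul_nonneg hδ.le hs0'
  have h2 : δ * (s : ℝ) ≤ 1 := by nlinarith
  obtain ⟨h3, h4⟩ := abs_le.1 h
  have h5 : |δ * a| ≤ R + 2 := abs_le.2 ⟨by linarith, by linarith⟩
  simpa [abs_mul, abs_of_pos hδ] using h5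

/-- **`stub_count` — lattice count.** The medial vertices whose midpoint lies in the closed
`1`-thickening of a compact set are, for every mesh `0 < δ ≤ 1`, contained in a finite set of cardinality
`≤ C δ⁻²`. [folklore] -/
theorem stub_count : ∀ (K : Set ℂ), IsCompact K → ∃ C : ℝ, ∀ (δ : ℝ), 0 < δ → δ ≤ 1 →
    ∃ S : Finset (Site 2 × Fin 2),
      (∀ p : Site 2 × Fin 2, medialPoint δ (medialVertexOf p) ∈ Metric.cthickening 1 K → p ∈ S) ∧
      δ ^ 2 * (S.card : ℝ) ≤ C := by
  intro K hK
  obtain ⟨R₀, hR₀⟩ := (Metric.isBounded_iff_subset_closedBall (0 : ℂ)).1 hK.isBounded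
  set R : ℝ := max R₀ 0 with hRdef
  have hR : 0 ≤ R := le_max_right _ _
  have hKR : K ⊆ Metric.closedBall 0 R :=
    hR₀.trans (Metric.closedBall_subset_closedBall (le_max_left _ _))
  refine ⟨2 * (2 * R + 7) ^ 2, fun δ hδ hδ1 => ?_⟩
  set N : ℕ := ⌈(R + 2) / δ⌉₊ with hNdef
  refine ⟨(Fintype.piFinset fun _ : Fin 2 => Finset.Icc (-(N : ℤ)) N) ×ˢ Finset.univ, ?_, ?_⟩
  · rintro ⟨x, i⟩ hp
    rw [hK.cthickening_eq_biUnion_closedBall zero_le_one, Set.mem_iUnion₂] at hp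
    obtain ⟨y, hyK, hy⟩ := hp
    have hyR : ‖y‖ ≤ R := by
      have := hKR hyK
      rwa [Metric.mem_closedBall, dist_zero_right] at this
    rw [Metric.mem_closedBall, dist_eq_norm] at hy
    have hz : ‖medialPoint δ (medialVertexOf (x, i))‖ ≤ R + 1 := by
      calc ‖medialPoint δ (medialVertexOf (x, i))‖
          = ‖(medialPoint δ (medialVertexOf (x, i)) - y) + y‖ := by rw [sub_add_cancel]
        _ ≤ ‖medialPoint δ (medialVertexOf (x, i)) - y‖ + ‖y‖ := norm_add_le _ _
        _ ≤ 1 + R := add_le_add hy hyR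
        _ = R + 1 := add_comm _ _
    have hre := (Complex.abs_re_le_norm _).trans hz
    have him := (Complex.abs_im_le_norm _).trans hz
    simp only [medialVertexOf, medialPoint_mk, Complex.div_ofNat_re, Complex.div_ofNat_im,
      Complex.add_re, Complex.add_im, meshPoint_re, meshPoint_im, Pi.add_apply, Int.cast_add]
      at hre him
    have hs0 : (0 : ℤ) ≤ (Pi.single i (1 : ℤ) : Site 2) 0 ∧ (Pi.single i (1 : ℤ) : Site 2) 0 ≤ 1 := by
      fin_cases i <;> simp
    have hs1 : (0 : ℤ) ≤ (Pi.single i (1 : ℤ) : Site 2) 1 ∧ (Pi.single i (1 : ℤ) : Site 2) 1 ≤ 1 := by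
      fin_cases i <;> simp
    have k0 : δ * |(x 0 : ℝ)| ≤ R + 2 := coord_bound hδ hδ1 hs0.1 hs0.2 hre
    have k1 : δ * |(x 1 : ℝ)| ≤ R + 2 := coord_bound hδ hδ1 hs1.1 hs1.2 him
    have key : ∀ a : ℤ, δ * |(a : ℝ)| ≤ R + 2 → a ∈ Finset.Icc (-(N : ℤ)) N := fun a ha => by
      have h1 : |(a : ℝ)| ≤ (R + 2) / δ := by rw [le_div_iff₀ hδ, mul_comm]; exact ha
      have h2 : |(a : ℝ)| ≤ (N : ℝ) := h1.trans (Nat.le_ceil _)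
      obtain ⟨h3, h4⟩ := abs_le.1 h2
      rw [Finset.mem_Icc]
      exact ⟨by exact_mod_cast h3, by exact_mod_cast h4⟩
    simp only [Finset.mem_product, Finset.mem_univ, and_true, Fintype.mem_piFinset,
      Fin.forall_fin_two]
    exact ⟨key _ k0, key _ k1⟩
  · rw [Finset.card_product, Finset.card_univ, Fintype.card_fin, Fintype.card_piFinset_const,
      Int.card_Icc]
    have hI : ((N : ℤ) + 1 - -(N : ℤ)).toNat = 2 * N + 1 := by
      rw [show (N : ℤ) + 1 - -(N : ℤ) = ((2 * N + 1 : ℕ) : ℤ) by push_cast; ring, Int.toNat_natCast]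
    rw [hI]
    push_cast
    have hN : (N : ℝ) < (R + 2) / δ + 1 := Nat.ceil_lt_add_one (by positivity)
    have hδN : δ * N ≤ R + 3 := by
      have h1 := mul_lt_mul_of_pos_left hN hδ
      have h2 : δ * ((R + 2) / δ + 1) = R + 2 + δ := by field_simp
      rw [h2] at h1
      linarith
    have h5 : δ * (2 * N + 1) ≤ 2 * R + 7 := by nlinarith
    have h6 : 0 ≤ δ * (2 * N + 1) := by positivity
    calc δ ^ 2 * ((2 * (N : ℝ) + 1) ^ 2 * 2) = 2 * (δ * (2 * N + 1)) ^ 2 := by ring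
      _ ≤ 2 * (2 * R + 7) ^ 2 := by
        have := pow_le_pow_left₀ h6 h5 2
        linarith

end Summit.CriticalPhenomena.CardyFormulaZ2.Theorems.WeakHolomorphy.SplitBypass

end
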